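import Mathlib
import Summits.Ventures.PercRepro2.Defs
import Summits.Ventures.PercRepro2.Graph
import Summits.Ventures.PercRepro2.Harris
import Summits.Ventures.PercRepro2.Events
import Summits.Ventures.PercRepro2.Independence
import Summits.Ventures.PercRepro2.Induced
import Summits.Ventures.PercRepro2.Exploration
import Summits.Ventures.PercRepro2.GateDefs
import Summits.Ventures.PercRepro2.GateAnatomy
import Summits.Ventures.PercRepro2.GateForest
import Summits.Ventures.PercRepro2.GateLSM
import Summits.Ventures.PercRepro2.HullTree
import Summits.Ventures.PercRepro2.GateFeedbackForest
import Summits.Ventures.PercRepro2.GateFeedback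
import Summits.Ventures.PercRepro2.GateFeedbackExit
import Summits.Ventures.PercRepro2.GateContract
import Summits.Ventures.PercRepro2.GateShadow
import Summits.Ventures.PercRepro2.GateSide
import Summits.Ventures.PercRepro2.GateSep
import Summits.Ventures.PercRepro2.SideCluster
import Summits.Ventures.PercRepro2.CactusDefs
import Summits.Ventures.PercRepro2.CactusTriangle
import Summits.Ventures.PercRepro2.CactusTriangleMass
import Summits.Ventures.PercRepro2.CactusCluster
import Summits.Ventures.PercRepro2.CactusDel
import Summits.Ventures.PercRepro2.CactusChain
import Summits.Ventures.PercRepro2.CactusKappa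
import Summits.Ventures.PercRepro2.CactusGate
import Summits.Ventures.PercRepro2.GateSupport

/-!
# The cluster law of `G` through the root's closed region `G[C]`
(blind cell PercRepro2, mine-c g11; proofs/MINEC-FEEDBACK.md §15.4; the articulation theorem is
in `CactusArticulation.lean`)

Let `C ∋ s` be a vertex set CLOSED between two vertices `am = a⁻, ap = a⁺ ∉ C`: every edge touching
`C` has its other end in `C ∪ {am, ap}`. A cluster of the root avoiding `am, ap` lies in `C`
(`cluster_subset_of_closed`), and for `W ⊆ C` the cluster event `{C(s) = W}` of `G` is the cluster
event of `G[C]` together with «every edge from `W` to `{am, ap}` is closed»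
(`clusterEvent_eq_restrict_closed`), so `P(C(s) = W) = massOn (G[C]) W · tauA W`
(`prob_clusterEvent_eq_massOn_closed`) with the closed-edge factor `tauA` modular on pairs inside
`C` (`tauA_mul`).
-/

namespace Summit.Ventures.PercRepro2

namespace CactusGate

open Cactus CactusChain GateSide

open scoped Classical

variable {V : Type*} {E : Type*} [Fintype E] [Fintype V]
variable {R : Type*} [Field R] [LinearOrder R] [IsStrictOrderedRing R]
variable {ends : E → Sym2 V}

/-! ## Clusters of the root stay in a closed region -/

omit [Fintype E] [Fintype V] in
/-- The cluster of `s ∈ C` avoiding `am, ap` lies in the closed region `C`. -/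
lemma cluster_subset_of_closed {C : Set V} {am ap s : V} (hs : s ∈ C)
    (hC : ∀ e, ∀ x ∈ ends e, x ∈ C → ∀ y ∈ ends e, y ∈ C ∨ y = am ∨ y = ap) {ω : Config E}
    (hm : am ∉ cluster ends ω s) (hpl : ap ∉ cluster ends ω s) :
    cluster ends ω s ⊆ C := by
  intro v hv
  have key : v ∈ {x | x ∈ cluster ends ω s → x ∈ C} := by
    refine mem_of_conn_of_closed (ends := ends) (ω := ω) ?_ (fun _ => hs) hv
    intro x hx y hxy hyc
    have hxc : x ∈ cluster ends ω s := by
      have : y ∈ cluster ends ω s := hyc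
      exact mem_cluster_of_adj this hxy.symm
    obtain ⟨_, e, _, hends⟩ := openGraph_adj.1 hxy
    rcases hC e x (by rw [hends]; exact Sym2.mem_mk_left _ _) (hx hxc) y
      (by rw [hends]; exact Sym2.mem_mk_right _ _) with h | h | h
    · exact h
    · exact (hm (h ▸ hyc)).elim
    · exact (hpl (h ▸ hyc)).elim
  exact key hv

/-! ## The cluster law of `G` through `G[C]` -/

/-- The edges between `W` and the pair `{am, ap}`. -/
noncomputable def EA (ends : E → Sym2 V) (am ap : V) (W : Finset V) : Finset E :=
  Finset.univ.filter fun e => ∃ x ∈ W, ends e = s(x, am) ∨ ends e = s(x, ap)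

/-- The closed-edge factor of the edges between `W` and `{am, ap}`. -/
noncomputable def tauA (p : E → R) (ends : E → Sym2 V) (am ap : V) (W : Finset V) : R :=
  ∏ e ∈ EA ends am ap W, (1 - p e)

omit [Fintype V] in
/-- `tauA` is nonnegative. -/
lemma tauA_nonneg {p : E → R} (hp : IsProbVec p) (am ap : V) (W : Finset V) :
    0 ≤ tauA p ends am ap W :=
  Finset.prod_nonneg fun e _ => sub_nonneg.2 (hp.le_one e)

omit [Fintype V] in
/-- The edges between `W₁ ∪ W₂` and the pair. -/
lemma EA_union (am ap : V) (W₁ W₂ : Finset V) :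
    EA ends am ap (W₁ ∪ W₂) = EA ends am ap W₁ ∪ EA ends am ap W₂ := by
  ext e
  simp only [EA, Finset.mem_filter, Finset.mem_univ, true_and, Finset.mem_union]
  constructor
  · rintro ⟨x, hx, hex⟩
    rcases hx with hx | hx
    · exact Or.inl ⟨x, hx, hex⟩
    · exact Or.inr ⟨x, hx, hex⟩
  · rintro (⟨x, hx, hex⟩ | ⟨x, hx, hex⟩)
    · exact ⟨x, Or.inl hx, hex⟩
    · exact ⟨x, Or.inr hx, hex⟩

omit [Fintype V] in
/-- The edges between `W₁ ∩ W₂` and the pair, for `W₁, W₂` inside a region missing the pair. -/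
lemma EA_inter {C : Set V} {am ap : V} (hm : am ∉ C) (hpl : ap ∉ C) {W₁ W₂ : Finset V}
    (hW₁ : (↑W₁ : Set V) ⊆ C) (hW₂ : (↑W₂ : Set V) ⊆ C) :
    EA ends am ap (W₁ ∩ W₂) = EA ends am ap W₁ ∩ EA ends am ap W₂ := by
  ext e
  simp only [EA, Finset.mem_filter, Finset.mem_univ, true_and, Finset.mem_inter]
  constructor
  · rintro ⟨x, ⟨hx1, hx2⟩, hex⟩
    exact ⟨⟨x, hx1, hex⟩, ⟨x, hx2, hex⟩⟩
  · rintro ⟨⟨x, hx, hex⟩, ⟨y, hy, hey⟩⟩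
    have hxC : x ∈ C := hW₁ (Finset.mem_coe.2 hx)
    have hyC : y ∈ C := hW₂ (Finset.mem_coe.2 hy)
    -- the non-pair end of `e` is unique
    have hxy : x = y := by
      rcases hex with hex | hex <;> rcases hey with hey | hey <;> rw [hex] at hey <;>
        rcases Sym2.eq_iff.1 hey with ⟨h, _⟩ | ⟨h1, _⟩ <;>
        first
        | exact h
        | exact (hm (by rw [← h1]; exact hxC)).elim
        | exact (hpl (by rw [← h1]; exact hxC)).elim
    subst hxy
    exact ⟨x, ⟨hx, hy⟩, hex⟩

omit [Fintype V] [LinearOrder R] [IsStrictOrderedRing R] in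
/-- `tauA` is modular on pairs inside the region. -/
lemma tauA_mul (p : E → R) {C : Set V} {am ap : V} (hm : am ∉ C) (hpl : ap ∉ C)
    {W₁ W₂ : Finset V} (hW₁ : (↑W₁ : Set V) ⊆ C) (hW₂ : (↑W₂ : Set V) ⊆ C) :
    tauA p ends am ap W₁ * tauA p ends am ap W₂ =
      tauA p ends am ap (W₁ ∩ W₂) * tauA p ends am ap (W₁ ∪ W₂) := by
  unfold tauA
  rw [EA_inter hm hpl hW₁ hW₂, EA_union,
    mul_comm (∏ e ∈ EA ends am ap W₁ ∩ EA ends am ap W₂, (1 - p e)), Finset.prod_union_inter]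

omit [Fintype V] in
/-- **The cluster event through `G[C]`**: for `W ⊆ C` in a closed region, `{C(s) = W}` is the
cluster event of `G[C]` together with «every edge from `W` to the pair is closed». -/
lemma clusterEvent_eq_restrict_closed {C : Set V} {am ap s : V}
    (hC : ∀ e, ∀ x ∈ ends e, x ∈ C → ∀ y ∈ ends e, y ∈ C ∨ y = am ∨ y = ap)
    (hm : am ∉ C) (hpl : ap ∉ C) {W : Finset V} (hW : (↑W : Set V) ⊆ C) (ω : Config E) :
    ω ∈ clusterEvent ends s (↑W : Set V) ↔
      clusterOn ends (within ends C) ω s = ↑W ∧ ∀ e ∈ EA ends am ap W, ω e = false := by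
  simp only [mem_clusterEvent, clusterOn]
  constructor
  · intro h
    have hsW : s ∈ W := by
      have : s ∈ cluster ends ω s := mem_cluster_self _ _ _
      rw [h] at this; exact Finset.mem_coe.1 this
    refine ⟨?_, ?_⟩
    · apply Set.Subset.antisymm
      · rw [← h]; exact cluster_mono (restrict_le _ _) s
      · intro x hx
        have hxc : x ∈ cluster ends ω s := by rw [h]; exact hx
        have key : x ∈ {v | v ∈ W → Conn ends (restrict (within ends C) ω) s v} := by
          refine mem_of_conn_of_closed (ends := ends) (ω := ω) ?_ (fun _ => conn_refl _ _ _) hxc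
          intro v hv v' hvv' hv'W
          have hv'c : v' ∈ cluster ends ω s := by rw [h]; exact Finset.mem_coe.2 hv'W
          have hvc : v ∈ cluster ends ω s := mem_cluster_of_adj hv'c hvv'.symm
          have hvW : v ∈ W := by rw [h] at hvc; exact Finset.mem_coe.1 hvc
          obtain ⟨_, e, he, hends⟩ := openGraph_adj.1 hvv'
          refine conn_trans (hv hvW) (conn_of_openAdj ⟨e, restrict_eq_true_iff.2 ⟨he, ?_⟩, hends⟩)
          exact ⟨v, hW (Finset.mem_coe.2 hvW), v', hW (Finset.mem_coe.2 hv'W), hends⟩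
        exact key (Finset.mem_coe.1 hx)
    · intro e he
      simp only [EA, Finset.mem_filter, Finset.mem_univ, true_and] at he
      obtain ⟨x, hx, hex⟩ := he
      by_contra hopen
      have hopen' : ω e = true := by
        cases h' : ω e with
        | true => rfl
        | false => exact absurd h' hopen
      have hsx : Conn ends ω s x := by
        have : x ∈ cluster ends ω s := by rw [h]; exact Finset.mem_coe.2 hx
        exact this
      rcases hex with hex | hex
      · have : am ∈ cluster ends ω s := hsx.trans (conn_of_openAdj ⟨e, hopen', hex⟩)
        rw [h] at this
        exact hm (hW this)
      · have : ap ∈ cluster ends ω s := hsx.trans (conn_of_openAdj ⟨e, hopen', hex⟩)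
        rw [h] at this
        exact hpl (hW this)
  · rintro ⟨hF, hclosed⟩
    apply Set.Subset.antisymm
    · intro x hx
      have key : x ∈ (↑W : Set V) := by
        refine mem_of_conn_of_closed (ends := ends) (ω := ω) ?_ ?_ hx
        · intro v hv v' hvv'
          obtain ⟨_, e, he, hends⟩ := openGraph_adj.1 hvv'
          have hvC : v ∈ C := hW hv
          rcases hC e v (by rw [hends]; exact Sym2.mem_mk_left _ _) hvC v'
            (by rw [hends]; exact Sym2.mem_mk_right _ _) with hv'C | hv'm | hv'p
          · -- an edge inside `C`: open in `G[C]`, so `v'` is in the `G[C]`-cluster `W`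
            have hc : v' ∈ cluster ends (restrict (within ends C) ω) s := by
              have hsv : Conn ends (restrict (within ends C) ω) s v := by
                have : v ∈ cluster ends (restrict (within ends C) ω) s := by rw [hF]; exact hv
                exact this
              exact hsv.trans (conn_of_openAdj ⟨e, restrict_eq_true_iff.2
                ⟨he, ⟨v, hvC, v', hv'C, hends⟩⟩, hends⟩)
            rw [hF] at hc; exact hc
          · subst hv'm
            have := hclosed e (by
              simp only [EA, Finset.mem_filter, Finset.mem_univ, true_and]
              exact ⟨v, Finset.mem_coe.1 hv, Or.inl hends⟩)
            rw [he] at this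
            exact (Bool.true_eq_false.mp this).elim
          · subst hv'p
            have := hclosed e (by
              simp only [EA, Finset.mem_filter, Finset.mem_univ, true_and]
              exact ⟨v, Finset.mem_coe.1 hv, Or.inr hends⟩)
            rw [he] at this
            exact (Bool.true_eq_false.mp this).elim
        · have : s ∈ cluster ends (restrict (within ends C) ω) s := mem_cluster_self _ _ _
          rw [hF] at this; exact this
      exact key
    · rw [← hF]; exact cluster_mono (restrict_le _ _) s

omit [Fintype V] [LinearOrder R] [IsStrictOrderedRing R] in
/-- **The cluster law of `G` through `G[C]`**: for `W ⊆ C`,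
`P(C(s) = W) = massOn (G[C]) W · tauA W`. -/
theorem prob_clusterEvent_eq_massOn_closed (p : E → R) {C : Set V} {am ap s : V}
    (hC : ∀ e, ∀ x ∈ ends e, x ∈ C → ∀ y ∈ ends e, y ∈ C ∨ y = am ∨ y = ap)
    (hm : am ∉ C) (hpl : ap ∉ C) {W : Finset V} (hW : (↑W : Set V) ⊆ C) :
    prob p (clusterEvent ends s (↑W : Set V)) =
      massOn p ends (within ends C) s W * tauA p ends am ap W := by
  have hset : clusterEvent ends s (↑W : Set V) =
      {ω | clusterOn ends (within ends C) ω s = ↑W} ∩ allClosed (EA ends am ap W) := by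
    ext ω
    rw [Set.mem_inter_iff, Set.mem_setOf_eq, clusterEvent_eq_restrict_closed hC hm hpl hW ω]
    rfl
  have hdep : DependsOn (· ∈ {ω : Config E | clusterOn ends (within ends C) ω s = ↑W})
      (within ends C) :=
    dependsOn_restrict (within ends C) (fun ω' => cluster ends ω' s = ↑W)
  have hdisj : Disjoint (within ends C) (↑(EA ends am ap W) : Set E) := by
    rw [Set.disjoint_left]
    intro e he he'
    simp only [Finset.coe_filter, EA, Finset.mem_univ, true_and, Set.mem_setOf_eq] at he'
    obtain ⟨x, _, hex⟩ := he'
    obtain ⟨y, hy, z, hz, hyz⟩ := he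
    rcases hex with hex | hex <;> rw [hex] at hyz <;>
      rcases Sym2.eq_iff.1 hyz with ⟨_, h⟩ | ⟨_, h⟩
    · exact hm (by rw [h]; exact hz)
    · exact hm (by rw [h]; exact hy)
    · exact hpl (by rw [h]; exact hz)
    · exact hpl (by rw [h]; exact hy)
  rw [hset, prob_inter_eq_mul_of_dependsOn p hdisj hdep (dependsOn_allClosed _), prob_allClosed]
  rfl

end CactusGate

end Summit.Ventures.PercRepro2
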